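import Mathlib
import HarnessLib
import HarnessLib.Audit
import Summits.ValiantsHypothesis.ValiantsHypothesis.Theorems.LacunarySymmetroidMatrixDescartesMiddleBinomial
import Summits.ValiantsHypothesis.ValiantsHypothesis.Theorems.LacunarySymmetroidMatrixDescartesZeroChangeConcavityBudgetWindows

/-!
# ValiantsHypothesis / LacunarySymmetroid — crux `MatrixDescartes` (stmt-ValiantsHypothesis-18050, V1), LINE (A) «product_plus_one»:
# the concavity budget on the PURE `(+,−,−)` CORE — the bad region is TERMINAL in every window, so `Z ≤ #BAD + 2m + 1`

Sixth part of the concavity budget (✓ `…ZeroChangeConcavityBudget{,Floor,General,Dip,Windows}`).  The open core of the floor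
`stub_oneChangeFloorK3` is the company of `(+,−,−)` rows (`a_{j0} > 0`, `a_{j1}, a_{j2} ≤ 0`, not both zero; every ratio `c/a`).  For such a
company the three Pick sums `Z₀ = Σ_j a_{j0}/g_j`, `M = Σ_j a_{j1}t^a/g_j` (`middleSum`), `T = Σ_j a_{j2}t^c/g_j` satisfy `Z₀ + M + T = m`
(`pick_sums_total`) and, at a critical point off the roots, `aM + cT = 0` (✓ `critical_relation`), hence `(c−a)·M = c·(m − Z₀)`:
BAD (`M ≤ 0`) ⟺ `Z₀ ≥ m` (`middleSum_nonpos_iff_of_critical`).  Since every row is strictly decreasing on `(0,∞)`, `Z₀` is STRICTLY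
INCREASING on every root-free interval (`bottomSum_lt_of_rootFree`, both signs of `g_j` at once: `1/g` increases when `g` decreases without
vanishing).  Consequences:

* ★ `pureT5_bad_after_bad` — on a root-free stretch, a critical point after a bad critical point is (strictly) bad: in every window the bad
  critical points form a TERMINAL block and the points where the middle letters win an INITIAL block;
* ★ `pureT5_card_middleGood_Ioo_le_one` — a root-free window carries AT MOST ONE critical point with `M > 0`;
* ★★ `posCrit_le_badBudget_pureT5` — `posCrit Φ ≤ #BAD + 2·#{positive roots} + 1 ≤ #BAD + 2m + 1` (constant ONE in front of `#BAD`, against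
  `2` for general companies), window form `card_crit_Ioo_le_badBudget_pureT5 : #crit(u,v) ≤ #BAD(u,v) + 1`, and the Euler-currency forms
  `floor_le_badBudget_pureT5` / `card_roots_euler_Ioo_le_badBudget_pureT5` on every support `d₀ < d₁ < d₂`.

Reading (NOTE-leafhand-lacsym5-g1 rev 2, the `(κ, h)` picture): with `h_j = (a_{j0} − g_j)/|g_j|` the bad condition is `Σ_unswitched h > Σ_switched h`,
a difference that increases through the window; the residual count of the core is therefore «how many critical points fit in the terminal bad
block of a window», i.e. a budget on bad points only, with the good initial block costing at most one point per window.

HONEST FRAMING: sector bookkeeping on the pure `(+,−,−)` class (rows `(−,+,+)` are the same rows up to sign and are not restated); def-free, no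
named facts, no sorry, standard axioms; closes NO stub by name; `OneChangeFloorK3`, `EulerBoundK3`, `ClassRowK3Linear`, `PPOPolyLaw`,
`MatrixDescartes` (stmt-ValiantsHypothesis-18050) OPEN; `VP ≠ VNP` is NOT proved and nothing here bears on it.

[folklore] Elementary real analysis and counting; no citation needed.
-/

set_option linter.dupNamespace false

namespace Summit.ValiantsHypothesis.ValiantsHypothesis.Theorems.LacunarySymmetroidMatrixDescartes

namespace ZeroChange

open Polynomial Finset Filter Topology

/-! ## The three Pick sums add up to `m`; at a critical point `BAD ⟺ Z₀ ≥ m` -/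

/-- `Z₀ + M + T = m` off the roots (`Σ_j g_j/g_j = m`). -/
theorem pick_sums_total (m a c : ℕ) (co : Fin m → ℝ × ℝ × ℝ) {t : ℝ}
    (hgt : ∀ j, (row a c (co j).1 (co j).2.1 (co j).2.2).eval t ≠ 0) :
    (∑ j, (co j).1 / (row a c (co j).1 (co j).2.1 (co j).2.2).eval t) + middleSum a c co t +
      ∑ j, (co j).2.2 * t ^ c / (row a c (co j).1 (co j).2.1 (co j).2.2).eval t = m := by
  rw [middleSum, ← sum_add_distrib, ← sum_add_distrib]
  have h1 : ∀ j ∈ (univ : Finset (Fin m)), (co j).1 / (row a c (co j).1 (co j).2.1 (co j).2.2).eval t +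
      (co j).2.1 * t ^ a / (row a c (co j).1 (co j).2.1 (co j).2.2).eval t +
      (co j).2.2 * t ^ c / (row a c (co j).1 (co j).2.1 (co j).2.2).eval t = 1 := by
    intro j _
    rw [← add_div, ← add_div, ← eval_row a c (co j).1 (co j).2.1 (co j).2.2 t, div_self (hgt j)]
  rw [sum_congr rfl h1]
  simp

/-- **At a critical point off the roots (`0 < a < c`): `M ≤ 0 ⟺ m ≤ Z₀`, and `M < 0 ⟺ m < Z₀`** (`(c−a)·M = c·(m − Z₀)`). -/
theorem middleSum_nonpos_iff_of_critical (m a c : ℕ) (ha : 0 < a) (hac : a < c) (co : Fin m → ℝ × ℝ × ℝ) {t : ℝ}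
    (hΦ : (∏ j, row a c (co j).1 (co j).2.1 (co j).2.2).eval t ≠ 0)
    (hcrit : (derivative (∏ j, row a c (co j).1 (co j).2.1 (co j).2.2)).eval t = 0) :
    (middleSum a c co t ≤ 0 ↔ (m : ℝ) ≤ ∑ j, (co j).1 / (row a c (co j).1 (co j).2.1 (co j).2.2).eval t) ∧
    (middleSum a c co t < 0 ↔ (m : ℝ) < ∑ j, (co j).1 / (row a c (co j).1 (co j).2.1 (co j).2.2).eval t) := by
  have hgt : ∀ j, (row a c (co j).1 (co j).2.1 (co j).2.2).eval t ≠ 0 := by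
    intro j h0
    apply hΦ
    rw [eval_prod]
    exact prod_eq_zero (mem_univ j) h0
  have htot := pick_sums_total m a c co hgt
  have hrel := critical_relation m a c co hΦ hcrit
  have ha' : (0 : ℝ) < a := by exact_mod_cast ha
  have hc' : (0 : ℝ) < c := by exact_mod_cast (ha.trans hac)
  have hca : (0 : ℝ) < c - a := by
    have : (a : ℝ) < c := by exact_mod_cast hac
    linarith
  -- `(c - a)·M = c·(m - Z₀)`
  have key : ((c : ℝ) - a) * middleSum a c co t =
      (c : ℝ) * ((m : ℝ) - ∑ j, (co j).1 / (row a c (co j).1 (co j).2.1 (co j).2.2).eval t) := by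
    have hT : (c : ℝ) * ∑ j, (co j).2.2 * t ^ c / (row a c (co j).1 (co j).2.1 (co j).2.2).eval t =
        -((a : ℝ) * middleSum a c co t) := by linarith
    have hT' : ∑ j, (co j).2.2 * t ^ c / (row a c (co j).1 (co j).2.1 (co j).2.2).eval t =
        (m : ℝ) - ∑ j, (co j).1 / (row a c (co j).1 (co j).2.1 (co j).2.2).eval t - middleSum a c co t := by linarith
    rw [hT'] at hT
    linarith
  constructor
  · constructor
    · intro hM
      nlinarith [mul_nonpos_iff.2 (Or.inl ⟨hca.le, hM⟩)]
    · intro hZ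
      by_contra hM
      push Not at hM
      nlinarith [mul_pos hca hM]
  · constructor
    · intro hM
      nlinarith [mul_neg_of_pos_of_neg hca hM]
    · intro hZ
      by_contra hM
      push Not at hM
      nlinarith [mul_nonneg hca.le hM]

/-! ## Pure `(+,−,−)` companies: `Z₀` increases strictly along root-free stretches -/

/-- A `(+,−,−)` row (`a₁, a₂ ≤ 0`, not both zero) is strictly decreasing on `(0,∞)`. -/
theorem eval_row_lt_of_pureT5 (a c : ℕ) (ha : 0 < a) (hac : a < c) {p q s : ℝ} (hq : q ≤ 0) (hs : s ≤ 0)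
    (hqs : q < 0 ∨ s < 0) {t₁ t₂ : ℝ} (h1 : 0 < t₁) (h12 : t₁ < t₂) :
    (row a c p q s).eval t₂ < (row a c p q s).eval t₁ := by
  rw [eval_row, eval_row]
  have hta : t₁ ^ a < t₂ ^ a := pow_lt_pow_left₀ h12 h1.le (by omega)
  have htc : t₁ ^ c < t₂ ^ c := pow_lt_pow_left₀ h12 h1.le (by omega)
  rcases hqs with hq' | hs'
  · nlinarith [mul_nonpos_iff.2 (Or.inr ⟨hs, (sub_pos.2 htc).le⟩), mul_neg_of_neg_of_pos hq' (sub_pos.2 hta)]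
  · nlinarith [mul_nonpos_iff.2 (Or.inr ⟨hq, (sub_pos.2 hta).le⟩), mul_neg_of_neg_of_pos hs' (sub_pos.2 htc)]

/-- **`Z₀` is strictly increasing on root-free stretches** of a pure `(+,−,−)` company (`m ≥ 1`): if no row vanishes on `[t₁, t₂] ⊂ (0,∞)`
then `Σ_j a_{j0}/g_j(t₁) < Σ_j a_{j0}/g_j(t₂)` — each `g_j` decreases without changing sign, so each `a_{j0}/g_j` increases. -/
theorem bottomSum_lt_of_rootFree (m a c : ℕ) (hm : 0 < m) (ha : 0 < a) (hac : a < c) (co : Fin m → ℝ × ℝ × ℝ)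
    (hT5 : ∀ j, 0 < (co j).1 ∧ (co j).2.1 ≤ 0 ∧ (co j).2.2 ≤ 0 ∧ ((co j).2.1 < 0 ∨ (co j).2.2 < 0))
    {t₁ t₂ : ℝ} (h1 : 0 < t₁) (h12 : t₁ < t₂)
    (hnoroot : ∀ z, t₁ ≤ z → z ≤ t₂ → (∏ j, row a c (co j).1 (co j).2.1 (co j).2.2).eval z ≠ 0) :
    ∑ j, (co j).1 / (row a c (co j).1 (co j).2.1 (co j).2.2).eval t₁ <
      ∑ j, (co j).1 / (row a c (co j).1 (co j).2.1 (co j).2.2).eval t₂ := by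
  classical
  have hgz : ∀ j z, t₁ ≤ z → z ≤ t₂ → (row a c (co j).1 (co j).2.1 (co j).2.2).eval z ≠ 0 := by
    intro j z hz1 hz2 h0
    apply hnoroot z hz1 hz2
    rw [eval_prod]
    exact prod_eq_zero (mem_univ j) h0
  haveI : Nonempty (Fin m) := ⟨⟨0, hm⟩⟩
  refine sum_lt_sum_of_nonempty univ_nonempty fun j _ => ?_
  obtain ⟨hp, hq, hs, hqs⟩ := hT5 j
  set g := row a c (co j).1 (co j).2.1 (co j).2.2 with hg
  have hdec : g.eval t₂ < g.eval t₁ := eval_row_lt_of_pureT5 a c ha hac hq hs hqs h1 h12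
  have hg1 : g.eval t₁ ≠ 0 := hgz j t₁ le_rfl h12.le
  have hg2 : g.eval t₂ ≠ 0 := hgz j t₂ h12.le le_rfl
  -- same sign at both ends (else a root in between)
  have hsame : 0 < g.eval t₁ * g.eval t₂ := by
    rcases lt_or_gt_of_ne hg1 with hneg | hpos
    · exact mul_pos_of_neg_of_neg hneg (hdec.trans hneg)
    · rcases lt_or_gt_of_ne hg2 with hneg2 | hpos2
      · exfalso
        obtain ⟨z, hz, hz0⟩ : ∃ z ∈ Set.Icc t₁ t₂, g.eval z = 0 :=
          intermediate_value_Icc' h12.le g.continuousOn_aeval ⟨hneg2.le, hpos.le⟩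
        exact hgz j z hz.1 hz.2 hz0
      · exact mul_pos hpos hpos2
  have hdiff : (co j).1 / g.eval t₂ - (co j).1 / g.eval t₁ =
      (co j).1 * (g.eval t₁ - g.eval t₂) / (g.eval t₁ * g.eval t₂) := by
    field_simp
  have hpos : 0 < (co j).1 * (g.eval t₁ - g.eval t₂) / (g.eval t₁ * g.eval t₂) :=
    div_pos (mul_pos hp (sub_pos.2 hdec)) hsame
  linarith

/-- ★ **BAD AFTER BAD** (pure `(+,−,−)` company with `m ≥ 1` rows, `0 < a < c`): if `t₁ < t₂` are critical points with no root of the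
product on `[t₁, t₂] ⊂ (0,∞)` and `M(t₁) ≤ 0`, then `M(t₂) < 0`.  The bad critical points of a window form a TERMINAL block. -/
theorem pureT5_bad_after_bad (m a c : ℕ) (hm : 0 < m) (ha : 0 < a) (hac : a < c) (co : Fin m → ℝ × ℝ × ℝ)
    (hT5 : ∀ j, 0 < (co j).1 ∧ (co j).2.1 ≤ 0 ∧ (co j).2.2 ≤ 0 ∧ ((co j).2.1 < 0 ∨ (co j).2.2 < 0))
    {t₁ t₂ : ℝ} (h1 : 0 < t₁) (h12 : t₁ < t₂)
    (hnoroot : ∀ z, t₁ ≤ z → z ≤ t₂ → (∏ j, row a c (co j).1 (co j).2.1 (co j).2.2).eval z ≠ 0)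
    (hcrit₁ : (derivative (∏ j, row a c (co j).1 (co j).2.1 (co j).2.2)).eval t₁ = 0)
    (hcrit₂ : (derivative (∏ j, row a c (co j).1 (co j).2.1 (co j).2.2)).eval t₂ = 0)
    (hbad : middleSum a c co t₁ ≤ 0) : middleSum a c co t₂ < 0 := by
  have hΦ1 := hnoroot t₁ le_rfl h12.le
  have hΦ2 := hnoroot t₂ h12.le le_rfl
  have hZ1 := ((middleSum_nonpos_iff_of_critical m a c ha hac co hΦ1 hcrit₁).1).1 hbad
  have hmono := bottomSum_lt_of_rootFree m a c hm ha hac co hT5 h1 h12 hnoroot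
  exact ((middleSum_nonpos_iff_of_critical m a c ha hac co hΦ2 hcrit₂).2).2 (lt_of_le_of_lt hZ1 hmono)

/-! ## Counting: at most one middle-good critical point per window; `Z ≤ #BAD + 2·#roots + 1` -/

/-- In a pure `(+,−,−)` company, two critical points `x < y` off the roots with `M > 0` at both enclose a root of the product. -/
theorem pureT5_exists_root_between_middleGood (m a c : ℕ) (ha : 0 < a) (hac : a < c) (co : Fin m → ℝ × ℝ × ℝ)
    (hT5 : ∀ j, 0 < (co j).1 ∧ (co j).2.1 ≤ 0 ∧ (co j).2.2 ≤ 0 ∧ ((co j).2.1 < 0 ∨ (co j).2.2 < 0))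
    {x y : ℝ} (hx0 : 0 < x) (hxy : x < y)
    (hx1 : (derivative (∏ j, row a c (co j).1 (co j).2.1 (co j).2.2)).eval x = 0)
    (hxΦ : (∏ j, row a c (co j).1 (co j).2.1 (co j).2.2).eval x ≠ 0) (hxM : 0 < middleSum a c co x)
    (hy1 : (derivative (∏ j, row a c (co j).1 (co j).2.1 (co j).2.2)).eval y = 0)
    (hyΦ : (∏ j, row a c (co j).1 (co j).2.1 (co j).2.2).eval y ≠ 0) (hyM : 0 < middleSum a c co y) :
    ∃ z, x < z ∧ z < y ∧ (∏ j, row a c (co j).1 (co j).2.1 (co j).2.2).eval z = 0 := by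
  classical
  by_contra hnone
  push Not at hnone
  rcases Nat.eq_zero_or_pos m with rfl | hm
  · simp [middleSum] at hxM
  set Φ : ℝ[X] := ∏ j, row a c (co j).1 (co j).2.1 (co j).2.2 with hΦdef
  -- both points are good; between them lies a non-good critical point `z`, which is bad ...
  have hxg := concavityCriterion_strict m a c ha hac co hx0 hxΦ hx1 hxM
  have hyg := concavityCriterion_strict m a c ha hac co (hx0.trans hxy) hyΦ hy1 hyM
  obtain ⟨z, hxz, hzy, hzcrit, hzng⟩ := exists_crit_not_good_between Φ hxy hx1 hxg hy1 hyg (fun z h1 h2 => hnone z h1 h2)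
  have hzΦ : Φ.eval z ≠ 0 := hnone z hxz hzy
  have hzM : middleSum a c co z ≤ 0 := by
    by_contra hM
    push Not at hM
    exact hzng (concavityCriterion_strict m a c ha hac co (hx0.trans hxz) hzΦ hzcrit hM)
  -- ... and then `y` is bad as well
  have hnoroot : ∀ w, z ≤ w → w ≤ y → Φ.eval w ≠ 0 := by
    intro w hzw hwy
    rcases eq_or_lt_of_le hwy with rfl | hwy'
    · exact hyΦ
    exact hnone w (lt_of_lt_of_le hxz hzw) hwy'
  have := pureT5_bad_after_bad m a c hm ha hac co hT5 (hx0.trans hxz) hzy hnoroot hzcrit hy1 hzM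
  linarith

/-- ★ **At most ONE middle-good critical point per window** (pure `(+,−,−)` company): on a root-free window `(u, v)` with `0 ≤ u` at most
one critical point has `M > 0`. -/
theorem pureT5_card_middleGood_Ioo_le_one (m a c : ℕ) (ha : 0 < a) (hac : a < c) (co : Fin m → ℝ × ℝ × ℝ)
    (hT5 : ∀ j, 0 < (co j).1 ∧ (co j).2.1 ≤ 0 ∧ (co j).2.2 ≤ 0 ∧ ((co j).2.1 < 0 ∨ (co j).2.2 < 0))
    {u v : ℝ} (hu : 0 ≤ u) (hnoroot : ∀ z, u < z → z < v → (∏ j, row a c (co j).1 (co j).2.1 (co j).2.2).eval z ≠ 0) :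
    (((derivative (∏ j, row a c (co j).1 (co j).2.1 (co j).2.2)).roots.toFinset.filter (fun t => 0 < t)).filter
        (fun t => (u < t ∧ t < v) ∧ 0 < middleSum a c co t)).card ≤ 1 := by
  classical
  set Φ : ℝ[X] := ∏ j, row a c (co j).1 (co j).2.1 (co j).2.2 with hΦdef
  refine card_le_one.2 fun x hx y hy => ?_
  rw [mem_filter, mem_filter, Multiset.mem_toFinset] at hx hy
  obtain ⟨⟨hxm, hx0⟩, ⟨hxu, hxv⟩, hxM⟩ := hx
  obtain ⟨⟨hym, -⟩, ⟨hyu, hyv⟩, hyM⟩ := hy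
  have hΦ' : derivative Φ ≠ 0 := fun h => by rw [h, roots_zero] at hxm; exact Multiset.notMem_zero _ hxm
  have hx1 : (derivative Φ).eval x = 0 := (mem_roots hΦ').1 hxm
  have hy1 : (derivative Φ).eval y = 0 := (mem_roots hΦ').1 hym
  by_contra hne
  rcases lt_or_gt_of_ne hne with hlt | hgt
  · obtain ⟨z, hxz, hzy, hz0⟩ := pureT5_exists_root_between_middleGood m a c ha hac co hT5 hx0 hlt hx1 (hnoroot x hxu hxv) hxM
      hy1 (hnoroot y hyu hyv) hyM
    exact hnoroot z (hxu.trans hxz) (hzy.trans hyv) hz0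
  · obtain ⟨z, hyz, hzx, hz0⟩ := pureT5_exists_root_between_middleGood m a c ha hac co hT5 (lt_of_le_of_lt hu hyu) hgt hy1
      (hnoroot y hyu hyv) hyM hx1 (hnoroot x hxu hxv) hxM
    exact hnoroot z (hyu.trans hyz) (hzx.trans hxv) hz0

/-- ★ **Window count on the core**: on a root-free window `(u, v)` (`0 ≤ u`) of a pure `(+,−,−)` company,
`#crit(u,v) ≤ #BAD(u,v) + 1`. -/
theorem card_crit_Ioo_le_badBudget_pureT5 (m a c : ℕ) (ha : 0 < a) (hac : a < c) (co : Fin m → ℝ × ℝ × ℝ)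
    (hT5 : ∀ j, 0 < (co j).1 ∧ (co j).2.1 ≤ 0 ∧ (co j).2.2 ≤ 0 ∧ ((co j).2.1 < 0 ∨ (co j).2.2 < 0))
    {u v : ℝ} (hu : 0 ≤ u) (hnoroot : ∀ z, u < z → z < v → (∏ j, row a c (co j).1 (co j).2.1 (co j).2.2).eval z ≠ 0) :
    (((derivative (∏ j, row a c (co j).1 (co j).2.1 (co j).2.2)).roots.toFinset.filter (fun t => 0 < t)).filter
        (fun t => u < t ∧ t < v)).card ≤
      (((derivative (∏ j, row a c (co j).1 (co j).2.1 (co j).2.2)).roots.toFinset.filter (fun t => 0 < t)).filter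
          (fun t => (u < t ∧ t < v) ∧ middleSum a c co t ≤ 0)).card + 1 := by
  classical
  set S := (derivative (∏ j, row a c (co j).1 (co j).2.1 (co j).2.2)).roots.toFinset.filter (fun t => 0 < t) with hS
  set W := S.filter (fun t => u < t ∧ t < v) with hW
  have hsplit := card_filter_add_card_filter_not (s := W) (fun t => 0 < middleSum a c co t)
  have h1 : (W.filter (fun t => 0 < middleSum a c co t)).card ≤ 1 := by
    rw [hW, filter_filter]
    exact pureT5_card_middleGood_Ioo_le_one m a c ha hac co hT5 hu hnoroot
  have h2 : W.filter (fun t => ¬ 0 < middleSum a c co t) = S.filter (fun t => (u < t ∧ t < v) ∧ middleSum a c co t ≤ 0) := by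
    rw [hW, filter_filter]
    refine filter_congr fun t _ => ?_
    simp only [not_lt]
  rw [← h2]
  omega

/-- ★★ **GLOBAL COUNT ON THE CORE**: for a pure `(+,−,−)` company on `0 < a < c`,
`posCrit Φ ≤ #BAD + 2·#{positive roots of Φ} + 1` (middle-good points are separated by roots). -/
theorem posCrit_le_badBudget_pureT5_roots (m a c : ℕ) (ha : 0 < a) (hac : a < c) (co : Fin m → ℝ × ℝ × ℝ)
    (hT5 : ∀ j, 0 < (co j).1 ∧ (co j).2.1 ≤ 0 ∧ (co j).2.2 ≤ 0 ∧ ((co j).2.1 < 0 ∨ (co j).2.2 < 0)) :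
    posCrit (∏ j, row a c (co j).1 (co j).2.1 (co j).2.2) ≤
      (((derivative (∏ j, row a c (co j).1 (co j).2.1 (co j).2.2)).roots.toFinset.filter (fun t => 0 < t)).filter
          (fun t => (∏ j, row a c (co j).1 (co j).2.1 (co j).2.2).eval t ≠ 0 ∧ middleSum a c co t ≤ 0)).card
        + 2 * ((∏ j, row a c (co j).1 (co j).2.1 (co j).2.2).roots.toFinset.filter (fun t => 0 < t)).card + 1 := by
  classical
  set Φ : ℝ[X] := ∏ j, row a c (co j).1 (co j).2.1 (co j).2.2 with hΦdef
  set S := (derivative Φ).roots.toFinset.filter (fun t => 0 < t) with hS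
  set R := Φ.roots.toFinset.filter (fun t => 0 < t) with hR
  set G := S.filter (fun t => Φ.eval t ≠ 0 ∧ 0 < middleSum a c co t) with hG
  set N := S.filter (fun t => ¬ (Φ.eval t ≠ 0 ∧ 0 < middleSum a c co t)) with hN
  set B := S.filter (fun t => Φ.eval t ≠ 0 ∧ middleSum a c co t ≤ 0) with hB
  have hpc : posCrit Φ = S.card := rfl
  have hSGN : G.card + N.card = S.card := card_filter_add_card_filter_not _
  by_cases hΦ' : derivative Φ = 0
  · have hS0 : S = ∅ := by simp [hS, hΦ']
    rw [hpc, hS0, card_empty]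
    exact Nat.zero_le _
  have hΦ : Φ ≠ 0 := fun h => hΦ' (by rw [h, derivative_zero])
  have hmemS : ∀ t, t ∈ S ↔ 0 < t ∧ (derivative Φ).eval t = 0 := by
    intro t; rw [hS, mem_filter, Multiset.mem_toFinset, mem_roots hΦ', IsRoot.def, and_comm]
  have hmemR : ∀ t, t ∈ R ↔ 0 < t ∧ Φ.eval t = 0 := by
    intro t; rw [hR, mem_filter, Multiset.mem_toFinset, mem_roots hΦ, IsRoot.def, and_comm]
  -- middle-good points are separated by roots
  have hsep : ∀ x ∈ G, ∀ y ∈ G, x < y → ∃ z ∈ R, x < z ∧ z < y := by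
    intro x hx y hy hxy
    rw [hG, mem_filter] at hx hy
    obtain ⟨hx0, hx1⟩ := (hmemS x).1 hx.1
    obtain ⟨-, hy1⟩ := (hmemS y).1 hy.1
    obtain ⟨z, hxz, hzy, hz0⟩ :=
      pureT5_exists_root_between_middleGood m a c ha hac co hT5 hx0 hxy hx1 hx.2.1 hx.2.2 hy1 hy.2.1 hy.2.2
    exact ⟨z, (hmemR z).2 ⟨hx0.trans hxz, hz0⟩, hxz, hzy⟩
  have hGle := card_le_card_add_one_of_separated G R hsep
  -- the others are roots or bad
  have hsub : N ⊆ R ∪ B := by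
    intro t ht
    rw [hN, mem_filter] at ht
    obtain ⟨htS, hng⟩ := ht
    obtain ⟨ht0, -⟩ := (hmemS t).1 htS
    by_cases hΦt : Φ.eval t = 0
    · exact mem_union_left _ ((hmemR t).2 ⟨ht0, hΦt⟩)
    · refine mem_union_right _ ?_
      rw [hB, mem_filter]
      refine ⟨htS, hΦt, ?_⟩
      by_contra hM
      push Not at hM
      exact hng ⟨hΦt, hM⟩
  have hNle : N.card ≤ R.card + B.card := (card_le_card hsub).trans (card_union_le _ _)
  omega

/-- ★★ **GLOBAL COUNT ON THE CORE, linear form**: a pure `(+,−,−)` company of `m` rows on `0 < a < c` has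
`posCrit Φ ≤ #BAD + 2m + 1`. -/
theorem posCrit_le_badBudget_pureT5 (m a c : ℕ) (ha : 0 < a) (hac : a < c) (co : Fin m → ℝ × ℝ × ℝ)
    (hT5 : ∀ j, 0 < (co j).1 ∧ (co j).2.1 ≤ 0 ∧ (co j).2.2 ≤ 0 ∧ ((co j).2.1 < 0 ∨ (co j).2.2 < 0)) :
    posCrit (∏ j, row a c (co j).1 (co j).2.1 (co j).2.2) ≤
      (((derivative (∏ j, row a c (co j).1 (co j).2.1 (co j).2.2)).roots.toFinset.filter (fun t => 0 < t)).filter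
          (fun t => (∏ j, row a c (co j).1 (co j).2.1 (co j).2.2).eval t ≠ 0 ∧ middleSum a c co t ≤ 0)).card + 2 * m + 1 := by
  have h1 := posCrit_le_badBudget_pureT5_roots m a c ha hac co hT5
  have hone : ∀ j, ¬ ((co j).1 * (co j).2.1 < 0 ∧ (co j).2.1 * (co j).2.2 < 0) := by
    intro j ⟨_, h2⟩
    obtain ⟨-, hq, hs, -⟩ := hT5 j
    nlinarith [mul_nonneg_of_nonpos_of_nonpos hq hs]
  have h2 := card_posRoots_prod_rows_le_of_oneChange m a c ha hac co hone
  omega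

/-! ## Euler currency -/

/-- ★★ **The floor's count on the pure `(+,−,−)` core, Euler currency**: on every support `d₀ < d₁ < d₂`, for every company with
`a_{j0} > 0`, `a_{j1}, a_{j2} ≤ 0` not both zero, `Z₊(eulerNumerator d a 0) ≤ #BAD + 2m + 1`. -/
theorem floor_le_badBudget_pureT5 {m : ℕ} (d : Fin 3 → ℕ) (h01 : d 0 < d 1) (h12 : d 1 < d 2) (a : Fin m → Fin 3 → ℝ)
    (hT5 : ∀ j, 0 < a j 0 ∧ a j 1 ≤ 0 ∧ a j 2 ≤ 0 ∧ (a j 1 < 0 ∨ a j 2 < 0)) :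
    ((∑ j, (∑ l, C (a j l * ((d l : ℝ) - d 0)) * X ^ (d l)) * ∏ i ∈ Finset.univ.erase j, (∑ l, C (a i l) * X ^ (d l))
        : ℝ[X]).roots.toFinset.filter (fun t => 0 < t)).card
      ≤ (((derivative (∏ j, row (d 1 - d 0) (d 2 - d 0) (a j 0) (a j 1) (a j 2))).roots.toFinset.filter
            (fun t => 0 < t)).filter
          (fun t => (∏ j, row (d 1 - d 0) (d 2 - d 0) (a j 0) (a j 1) (a j 2)).eval t ≠ 0 ∧
            middleSum (d 1 - d 0) (d 2 - d 0) (fun j => (a j 0, a j 1, a j 2)) t ≤ 0)).card + 2 * m + 1 := by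
  rw [card_posRoots_euler_bottom_eq_posCrit d h01.le (h01.le.trans h12.le) a]
  exact posCrit_le_badBudget_pureT5 m (d 1 - d 0) (d 2 - d 0) (by omega) (by omega)
    (fun j => (a j 0, a j 1, a j 2)) (fun j => hT5 j)

/-- ★ **Window count on the core, Euler currency**: on a root-free window `(u, v)` (`0 ≤ u`) of a pure `(+,−,−)` company on `d₀ < d₁ < d₂`,
`#{roots of eulerNumerator d a 0 in (u,v)} ≤ #BAD(u,v) + 1`. -/
theorem card_roots_euler_Ioo_le_badBudget_pureT5 {m : ℕ} (d : Fin 3 → ℕ) (h01 : d 0 < d 1) (h12 : d 1 < d 2)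
    (a : Fin m → Fin 3 → ℝ) (hT5 : ∀ j, 0 < a j 0 ∧ a j 1 ≤ 0 ∧ a j 2 ≤ 0 ∧ (a j 1 < 0 ∨ a j 2 < 0)) {u v : ℝ} (hu : 0 ≤ u)
    (hnoroot : ∀ z, u < z → z < v → (∏ j, row (d 1 - d 0) (d 2 - d 0) (a j 0) (a j 1) (a j 2)).eval z ≠ 0) :
    (((∑ j, (∑ l, C (a j l * ((d l : ℝ) - d 0)) * X ^ (d l)) * ∏ i ∈ Finset.univ.erase j, (∑ l, C (a i l) * X ^ (d l))
        : ℝ[X]).roots.toFinset.filter (fun t => 0 < t)).filter (fun t => u < t ∧ t < v)).card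
      ≤ (((derivative (∏ j, row (d 1 - d 0) (d 2 - d 0) (a j 0) (a j 1) (a j 2))).roots.toFinset.filter
            (fun t => 0 < t)).filter
          (fun t => (u < t ∧ t < v) ∧ middleSum (d 1 - d 0) (d 2 - d 0) (fun j => (a j 0, a j 1, a j 2)) t ≤ 0)).card + 1 := by
  rw [posRootSet_euler_bottom_eq d h01.le (h01.le.trans h12.le) a]
  exact card_crit_Ioo_le_badBudget_pureT5 m (d 1 - d 0) (d 2 - d 0) (by omega) (by omega)
    (fun j => (a j 0, a j 1, a j 2)) (fun j => hT5 j) hu hnoroot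

end ZeroChange

end Summit.ValiantsHypothesis.ValiantsHypothesis.Theorems.LacunarySymmetroidMatrixDescartes
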